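import Literature.Combinatorics.StablePolynomials.HThetaStability
import Literature.Combinatorics.StablePolynomials.MasterCompositionAllDegrees
import HarnessLib

/-!
# The master composition theorem for every half-plane `H_θ` (Borcea–Brändén II, Cor. 3.4 (a)) and Gauss–Lucas

J. Borcea, P. Brändén, *The Lee–Yang and Pólya–Schur programs. II. Theory of stable polynomials and
applications*, Comm. Pure Appl. Math. 62 (2009) 1595–1631 (arXiv:0809.3087), §3:

> **Corollary 3.4.** Let `κ ∈ ℕⁿ` and `f, g ∈ ℂ[z_1,…,z_n,w_1,…,w_n]` be of the form
> `f(z,w) = Σ_{α ≤ κ} binom(κ,α) P_α(w) z^α`, `g(z,w) = Σ_{α ≤ κ} binom(κ,α) Q_α(z) w^α`.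
> (a) If `f` and `g` are `H_θ`-stable for some `0 ≤ θ < 2π`, then so is the polynomial
> `Σ_{α ≤ κ} binom(κ,α) P_α(w) Q_{κ-α}(z)` … unless it is identically zero.
>
> **Remark 3.1.** Theorem 3.1 trivially implies the following (well-known) multivariate Gauss–Lucas theorem: if
> `f ∈ ℂ_κ[z_1,…,z_n]` is `H_θ`-stable for some `0 ≤ θ < 2π` then `∂f/∂z_i` is `H_θ`-stable or identically zero
> for any `i ∈ [n]`.

The tree proves Cor. 3.4 (a) for `H_0 = ℋ` and every `κ` (`mv_master_composition'`,
`MasterCompositionAllDegrees.lean`) and Theorem 3.1 / `H_θ`-stability with the rotation `rotateVars`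
(`HThetaStability.lean`). Here the general half-plane is reached by rotating all `2n` variables: with `u = e^{-iθ}`,
`f(uz,uw) = Σ binom(κ,α) [u^{|α|} P_α(u w)] z^α` and `g(uz,uw) = Σ binom(κ,α) [u^{|α|} Q_α(u z)] w^α` are again of
the shape of the corollary (`rotateVars_mvCompositionF`, `rotateVars_mvCompositionG`), they are `ℋ`-stable iff
`f, g` are `H_θ`-stable ("equivalent modulo rotations"), and the polynomial (a) built from the rotated data is
`u^{|κ|} · h(uz,uw)` (`mvComposition_rotateVars`); so `mv_master_composition'` gives Cor. 3.4 (a) for `H_θ`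
(`mv_master_composition_hTheta`). The Gauss–Lucas statement of Remark 3.1 is obtained from the tree's `ℋ`-case
(`IsUpperHalfPlaneStable.pderiv`, `Limits.lean`) by the same rotation, using `∂_i [f(uz)] = u (∂_i f)(uz)`
(`pderiv_rotateVars`) — a deviation from the remark, which reads it off Theorem 3.1 (b).

## Contents

* §1 `rotateVars_comp_rename`, `rotateVars_rename`, `rotateVars_prod_X_pow`.
* §2 `rotateVars_mvCompositionF`, `rotateVars_mvCompositionG`, `mvComposition_rotateVars`.
* §3 **`mv_master_composition_hTheta`** (Cor. 3.4 (a), every `H_θ`, every `κ`).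
* §4 `pderiv_rotateVars`, **`IsHThetaStable.pderiv`** (Remark 3.1, multivariate Gauss–Lucas for `H_θ`).

## References

* [BorceaBranden2009II] J. Borcea, P. Brändén, Comm. Pure Appl. Math. 62 (2009) 1595–1631, §3 Cor. 3.4 (a),
  Remark 3.1; §1 ("equivalent modulo rotations").
-/

noncomputable section

open MvPolynomial Finset

namespace Literature.Combinatorics.StablePolynomials

/-! ## §1 Rotations, renamings and monomials -/

section Rotate

variable {σ σ' : Type*}

/-- Rotating commutes with renaming the variables. [cite: BorceaBranden2009II, §1 ("equivalent modulo
rotations")] -/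
theorem rotateVars_comp_rename (u : ℂ) (e : σ → σ') :
    (rotateVars u).comp (rename e) = (rename e).comp (rotateVars u : MvPolynomial σ ℂ →ₐ[ℂ] MvPolynomial σ ℂ) :=
  algHom_ext fun i => by
    rw [AlgHom.comp_apply, AlgHom.comp_apply, rename_X, rotateVars_X, rotateVars_X, _root_.map_mul, rename_C,
      rename_X]

/-- `(rename e f)(u·) = rename e (f(u·))`. [cite: BorceaBranden2009II, §1 ("equivalent modulo rotations")] -/
theorem rotateVars_rename (u : ℂ) (e : σ → σ') (p : MvPolynomial σ ℂ) :
    rotateVars u (rename e p) = rename e (rotateVars u p) := by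
  rw [← AlgHom.comp_apply, rotateVars_comp_rename, AlgHom.comp_apply]

/-- **`(uz)^α = u^{|α|} z^α`.** [cite: BorceaBranden2009II, §1 ("equivalent modulo rotations")] -/
theorem rotateVars_prod_X_pow {τ : Type*} [Fintype τ] (u : ℂ) (α : τ → ℕ) (e : τ → σ) :
    rotateVars u (∏ i, X (e i) ^ α i : MvPolynomial σ ℂ) = C (u ^ ∑ i, α i) * ∏ i, X (e i) ^ α i := by
  rw [_root_.map_prod (rotateVars u), ← prod_pow_eq_pow_sum, _root_.map_prod C, ← prod_mul_distrib]
  refine prod_congr rfl fun i _ => ?_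
  rw [map_pow, rotateVars_X, mul_pow, C_pow]

end Rotate

/-! ## §2 Rotating `f`, `g` and `h` -/

section Polys

variable {τ : Type*} [Fintype τ] [DecidableEq τ]

/-- **`f(uz,uw)` is of the shape of Cor. 3.4 with `P_α ↦ u^{|α|} P_α(u·)`.** [cite: BorceaBranden2009II, §3
Cor. 3.4 (the polynomial `f`)] -/
theorem rotateVars_mvCompositionF (u : ℂ) (κ : τ → ℕ) (P : (τ → ℕ) → MvPolynomial τ ℂ) :
    rotateVars u (mvCompositionF κ P) =
      mvCompositionF κ fun α => u ^ (∑ i, α i) • rotateVars u (P α) := by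
  rw [mvCompositionF, mvCompositionF, map_sum]
  refine sum_congr rfl fun α _ => ?_
  rw [map_smul, _root_.map_mul, rotateVars_prod_X_pow, rotateVars_rename, map_smul, smul_eq_C_mul,
    smul_eq_C_mul, smul_eq_C_mul]
  ring

/-- **`g(uz,uw)` is of the shape of Cor. 3.4 with `Q_α ↦ u^{|α|} Q_α(u·)`.** [cite: BorceaBranden2009II, §3
Cor. 3.4 (the polynomial `g`)] -/
theorem rotateVars_mvCompositionG (u : ℂ) (κ : τ → ℕ) (Q : (τ → ℕ) → MvPolynomial τ ℂ) :
    rotateVars u (mvCompositionG κ Q) =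
      mvCompositionG κ fun α => u ^ (∑ i, α i) • rotateVars u (Q α) := by
  rw [mvCompositionG, mvCompositionG, map_sum]
  refine sum_congr rfl fun α _ => ?_
  rw [map_smul, _root_.map_mul, rotateVars_prod_X_pow, rotateVars_rename, map_smul, smul_eq_C_mul,
    smul_eq_C_mul, smul_eq_C_mul]
  ring

/-- **The polynomial (a) of the rotated data is `u^{|κ|} h(uz,uw)`.** [cite: BorceaBranden2009II, §3 Cor. 3.4
(a)] -/
theorem mvComposition_rotateVars (u : ℂ) (κ : τ → ℕ) (P Q : (τ → ℕ) → MvPolynomial τ ℂ) :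
    mvComposition κ (fun α => u ^ (∑ i, α i) • rotateVars u (P α)) (fun α => u ^ (∑ i, α i) • rotateVars u (Q α)) =
      C (u ^ ∑ i, κ i) * rotateVars u (mvComposition κ P Q) := by
  rw [mvComposition, mvComposition, map_sum, mul_sum]
  refine sum_congr rfl fun α hα => ?_
  have hα' := mem_box_iff.1 hα
  have hpow : u ^ (∑ i, (κ - α) i) * u ^ (∑ i, α i) = u ^ ∑ i, κ i := by
    rw [← pow_add, ← sum_add_distrib]
    exact congrArg (u ^ ·) (sum_congr rfl fun i _ => by rw [Pi.sub_apply, Nat.sub_add_cancel (hα' i)])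
  rw [map_smul, map_smul, map_smul, _root_.map_mul, rotateVars_rename, rotateVars_rename, ← hpow, C_mul]
  simp only [smul_eq_C_mul]
  ring

end Polys

/-! ## §3 Corollary 3.4 (a) for every `H_θ` -/

section Main

variable {τ : Type*} [Fintype τ] [DecidableEq τ]

/-- **Borcea–Brändén II, Corollary 3.4 (a), for every half-plane `H_θ`, every number of variables and every
`κ ∈ ℕⁿ`.** If `f(z,w) = Σ_{α≤κ} binom(κ,α) P_α(w) z^α` and `g(z,w) = Σ_{α≤κ} binom(κ,α) Q_α(z) w^α` are
`H_θ`-stable, then `h(z,w) = Σ_{α≤κ} binom(κ,α) P_α(w) Q_{κ-α}(z)` is `H_θ`-stable or identically zero.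
[cite: BorceaBranden2009II, §3 Cor. 3.4 (a)] -/
theorem mv_master_composition_hTheta (θ : ℝ) {κ : τ → ℕ} (P Q : (τ → ℕ) → MvPolynomial τ ℂ)
    (hf : IsHThetaStable θ (mvCompositionF κ P)) (hg : IsHThetaStable θ (mvCompositionG κ Q)) :
    mvComposition κ P Q = 0 ∨ IsHThetaStable θ (mvComposition κ P Q) := by
  have hu : thetaUnit θ ≠ 0 := thetaUnit_ne_zero θ
  rw [isHThetaStable_iff_rotateVars, rotateVars_mvCompositionF] at hf
  rw [isHThetaStable_iff_rotateVars, rotateVars_mvCompositionG] at hg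
  have h := mv_master_composition' _ _ hf hg
  rw [mvComposition_rotateVars] at h
  have hc : (C ((thetaUnit θ)⁻¹ ^ ∑ i, κ i) : MvPolynomial (τ ⊕ τ) ℂ) ≠ 0 :=
    fun h0 => pow_ne_zero _ (inv_ne_zero hu) (C_eq_zero.1 h0)
  rcases h with h | h
  · left
    have h1 : rotateVars (thetaUnit θ)⁻¹ (mvComposition κ P Q) = 0 := (mul_eq_zero.1 h).resolve_left hc
    have h2 := congrArg (rotateVars (thetaUnit θ)) h1
    rwa [rotateVars_rotateVars_inv hu, map_zero] at h2
  · right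
    rw [isHThetaStable_iff_rotateVars]
    exact (isUpperHalfPlaneStable_mul_iff.1 h).2

end Main

/-! ## §4 Gauss–Lucas for `H_θ` (Remark 3.1) -/

section GaussLucas

variable {σ : Type*}

/-- **`∂_i [f(uz)] = u · (∂_i f)(uz)`.** [cite: BorceaBranden2009II, §3 Remark 3.1] -/
theorem pderiv_rotateVars [DecidableEq σ] (u : ℂ) (i : σ) (p : MvPolynomial σ ℂ) :
    MvPolynomial.pderiv i (rotateVars u p) = C u * rotateVars u (MvPolynomial.pderiv i p) := by
  induction p using MvPolynomial.induction_on with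
  | C a => rw [rotateVars_C, pderiv_C, map_zero, mul_zero]
  | add p q hp hq => simp only [map_add, hp, hq, mul_add]
  | mul_X p j hp =>
    have h1 : rotateVars u (p * X j) = rotateVars u p * (C u * X j) := by
      rw [_root_.map_mul (rotateVars u), rotateVars_X]
    have h2 : rotateVars u (MvPolynomial.pderiv i (p * X j)) =
        rotateVars u (MvPolynomial.pderiv i p) * (C u * X j) +
          rotateVars u p * rotateVars u (MvPolynomial.pderiv i (X j)) := by
      rw [pderiv_mul, map_add (rotateVars u), _root_.map_mul (rotateVars u), _root_.map_mul (rotateVars u),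
        rotateVars_X]
    rw [h1, h2, pderiv_mul, hp, pderiv_C_mul]
    by_cases hij : j = i
    · subst hij
      rw [pderiv_X_self, map_one]
      ring
    · rw [pderiv_X_of_ne hij, map_zero]
      ring

/-- **Multivariate Gauss–Lucas for `H_θ` (Remark 3.1)**: if `f` is `H_θ`-stable then `∂f/∂z_i` is `H_θ`-stable
or identically zero. (From the `ℋ`-case in the tree, `IsUpperHalfPlaneStable.pderiv`, by rotation.)
[cite: BorceaBranden2009II, §3 Remark 3.1] -/
theorem IsHThetaStable.pderiv [Fintype σ] [DecidableEq σ] {θ : ℝ} {p : MvPolynomial σ ℂ}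
    (hp : IsHThetaStable θ p) (i : σ) :
    MvPolynomial.pderiv i p = 0 ∨ IsHThetaStable θ (MvPolynomial.pderiv i p) := by
  have hu : thetaUnit θ ≠ 0 := thetaUnit_ne_zero θ
  have h := IsUpperHalfPlaneStable.pderiv ((isHThetaStable_iff_rotateVars θ p).1 hp) i
  rw [pderiv_rotateVars] at h
  have hc : (C (thetaUnit θ)⁻¹ : MvPolynomial σ ℂ) ≠ 0 := fun h0 => inv_ne_zero hu (C_eq_zero.1 h0)
  rcases h with h | h
  · left
    have h1 : rotateVars (thetaUnit θ)⁻¹ (MvPolynomial.pderiv i p) = 0 := (mul_eq_zero.1 h).resolve_left hc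
    have h2 := congrArg (rotateVars (thetaUnit θ)) h1
    rwa [rotateVars_rotateVars_inv hu, map_zero] at h2
  · right
    rw [isHThetaStable_iff_rotateVars]
    exact (isUpperHalfPlaneStable_mul_iff.1 h).2

end GaussLucas

end Literature.Combinatorics.StablePolynomials

end
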